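import Summits.BirchSwinnertonDyer.BirchSwinnertonDyer.Theorems.ShadowIsolationShaCotorsionReducibleReductions
import Literature.NumberTheory.EllipticCurves.ModPIrreducibleCofinite

/-!
# BirchSwinnertonDyer / ShadowIsolation — crux `ShaCotorsionReducible` (stmt-BirchSwinnertonDyer-15277)
# is an OUTPUT of the route: `ShadowIsolationThesis → SelmerRankSmallImage → ShaCotorsionReducible`

Lead c3 (line `registered`). The residual Eisenstein crux `R = ShaCotorsionReducible` (at a good ordinary
prime `p ≥ 5` with `E[p]` REDUCIBLE, `corank_{ℤ_p} Ш(E/ℚ)[p^∞] = 0`) is IMPLIED by two other hypotheses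
of the route's deciding theorem `closes` — its target `X = ShadowIsolationThesis` (stmt-15487: at every
good ordinary `p ≥ 5` with `E[p]` IRREDUCIBLE, `corank Ш[p^∞] = 0 ∧ corank Sel_{p^∞} = r_an`) and the
shared crux `SelmerRankSmallImage` (stmt-14418: at every good ordinary `p ≥ 5` with `ρ̄_{E,p}` NOT
surjective, `corank Sel_{p^∞} = r_an`) — together with the PROVED irreducible prime supply
`WeierstrassCurve.exists_gt_mem_goodOrdinaryPrimes_hasIrreducibleModPGaloisRep` (AEC Cor. IX.6.3 over
`ℚ` + infinitely many good ordinary primes; axioms `propext`/`Classical.choice`/`Quot.sound`; it is the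
content of the route's own support item `PrimeSupplyIrreducible`, stmt-15491):

  given `W` (globally minimal, elliptic) and an Eisenstein good ordinary `p ≥ 5`, pick an auxiliary
  good ordinary `q ≥ 5` with `E[q]` irreducible; `X` at `q` and Greenberg's identity at `q`
  (`corank Sel_{q^∞} = rank + corank Ш[q^∞]`, tree theorem) give `rank E(ℚ) = r_an`; `SmallImage` at
  `p` (reducible ⇒ not surjective) gives `corank Sel_{p^∞} = r_an = rank`; Greenberg's identity at `p`
  gives `corank Ш[p^∞] = 0`.

So `R` is REDUNDANT among the hypotheses of `closes : Isolation → Shadow → UB → LB → SmallImage → R →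
BirchSwinnertonDyer` (the first five already give `X` by the glue `CruxesToTarget`, proved inline in
`closes`). Consequences recorded here, sorry-free, standard axioms:

* `shaCotorsionReducible_of_thesis_of_smallImage_of_supply` — `X → SmallImage → PrimeSupplyIrreducible → R`
  (pure bookkeeping over the route file: NO import beyond the route's own cone is needed for this form);
* `shaCotorsionReducible_of_thesis_of_smallImage` — `X → SmallImage → R`, discharging the supply by the
  tree theorem (this file imports `ModPIrreducibleCofinite`; a Theorems file may).

PLANNER RECIPE (D-0014 plan note, not a prover action): `route edit --closes-file` replacing the
hypothesis `hRed : ShaCotorsionReducible` of `closes` by `hPS : PrimeSupplyIrreducible` (already a decl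
of the route file, item 15491, provable now by one line over `ModPIrreducibleCofinite` in a Theorems
file) — the route file's import cone is UNCHANGED (the rev-3 objection to c2's `ClosesWithoutR.lean`,
which imported `ModPIrreducibleCofinite` into the route file, does not apply); the certified body is
`Cruxes/ShaCotorsionReducible/ClosesWithSupply.lean`. As a crux in its own right `R` is
`Ш[p^∞]`-cotorsion at an Eisenstein prime, open from `min(corank Sel_{p^∞}, r_an) ≥ 2`
(`ShadowIsolationShaCotorsionReducibleReductions`, `…Residue`).
-/

-- D-0017: single-problem summit, so `Summit.BirchSwinnertonDyer.BirchSwinnertonDyer.…` repeats a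
-- namespace BY DESIGN.
set_option linter.dupNamespace false

namespace Summit.BirchSwinnertonDyer.BirchSwinnertonDyer.Theorems

open Literature.NumberTheory.EllipticCurves
open Summit.BirchSwinnertonDyer.BirchSwinnertonDyer.Theses

/-- **`R` from `X`, `SmallImage` and the prime supply (route-cone form).** For the route
`ShadowIsolation`: `ShadowIsolationThesis → SelmerRankSmallImage → PrimeSupplyIrreducible →
ShaCotorsionReducible`. Proof: at the Eisenstein prime `p` of `W`, take an auxiliary good ordinary
`q ≥ 5` with `E[q]` irreducible (supply); `X` at `q` plus Greenberg's identity
`corank Sel_{q^∞} = rank + corank Ш[q^∞]` (LNM 1716, §1; tree theorem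
`WeierstrassCurve.selmerCorank_eq_mordellWeilRank_add_holds`) give `rank = r_an`; `SmallImage` at `p`
(reducible ⇒ `ρ̄_{E,p}` not surjective, `not_hasSurjectiveModNGaloisRep_of_not_hasIrreducibleModPGaloisRep`)
gives `corank Sel_{p^∞} = r_an = rank`, and the identity at `p` gives `corank Ш[p^∞] = 0`.
[cite: Greenberg1999LNM, §1 pp. 54–57] -/
theorem shaCotorsionReducible_of_thesis_of_smallImage_of_supply
    (hX : ShadowIsolation.ShadowIsolationThesis) (hSI : ShadowIsolation.SelmerRankSmallImage)
    (hPS : ShadowIsolation.PrimeSupplyIrreducible) :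
    ShadowIsolation.ShaCotorsionReducible := by
  intro W _ _ p _ h5 hgood hord hred
  -- auxiliary good ordinary prime `q ≥ 5` with `E[q]` irreducible
  obtain ⟨q, hq, h5q, hqgood, hqord, hqirr⟩ := hPS W
  haveI := hq
  -- `X` at `q` and Greenberg's identity at `q`: `rank = r_an`
  obtain ⟨hshaq, hselq⟩ := hX W q h5q hqgood hqord hqirr
  have hIdq : W.selmerCorank q = W.mordellWeilRank + W.shaCorank q :=
    W.selmerCorank_eq_mordellWeilRank_add_holds q
  -- `SmallImage` at `p` and Greenberg's identity at `p`: `corank Ш[p^∞] = 0`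
  have hselp : W.selmerCorank p = W.analyticRank :=
    hSI W p h5 hgood hord (not_hasSurjectiveModNGaloisRep_of_not_hasIrreducibleModPGaloisRep W p hred)
  have hIdp : W.selmerCorank p = W.mordellWeilRank + W.shaCorank p :=
    W.selmerCorank_eq_mordellWeilRank_add_holds p
  omega


/-- **`R` from the route's other items (literal form).** Every hypothesis of the deciding theorem
`closes` other than `R` — `IsolationOfAccidentalZeros`, `PhantomShadow`, `SelmerRankUB`, `SelmerRankLB`,
`SelmerRankSmallImage` — together with the route's three provable-now support items `CruxesToTarget`
(stmt-15492), `ShaUnboundedOfCorank` (stmt-15490) and `PrimeSupplyIrreducible` (stmt-15491) imply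
`R = ShaCotorsionReducible`: the glue gives the target `X`, and `X → SmallImage → PrimeSupply → R` is
`shaCotorsionReducible_of_thesis_of_smallImage_of_supply`. (Only the route file's own vocabulary is
used; no import beyond the route cone is needed for this declaration.) [cite: Greenberg1999LNM, §1 pp. 54–57] -/
theorem shaCotorsionReducible_of_route_items
    (hG : ShadowIsolation.CruxesToTarget) (hAlg : ShadowIsolation.ShaUnboundedOfCorank)
    (hPS : ShadowIsolation.PrimeSupplyIrreducible)
    (hIso : ShadowIsolation.IsolationOfAccidentalZeros) (hSh : ShadowIsolation.PhantomShadow)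
    (hUB : ShadowIsolation.SelmerRankUB) (hLB : ShadowIsolation.SelmerRankLB)
    (hSI : ShadowIsolation.SelmerRankSmallImage) :
    ShadowIsolation.ShaCotorsionReducible :=
  shaCotorsionReducible_of_thesis_of_smallImage_of_supply (hG hIso hSh hAlg hUB hLB hSI) hSI hPS

/-- **`R` is an output of the route: `ShadowIsolationThesis → SelmerRankSmallImage →
ShaCotorsionReducible`.** The supply hypothesis of the previous theorem is the PROVED tree theorem
`WeierstrassCurve.exists_gt_mem_goodOrdinaryPrimes_hasIrreducibleModPGaloisRep` (every globally
minimal elliptic `W/ℚ` has good ordinary primes `q > N` with `E[q]` irreducible, for every `N`;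
Silverman, *AEC*, Cor. IX.6.3 with the infinitude of good ordinary primes). Hence the residual
Eisenstein crux (stmt-BirchSwinnertonDyer-15277) follows from the route's target (stmt-15487) and its
small-image crux (stmt-14418) alone. [cite: SilvermanAEC2009, Cor. IX.6.3]
[cite: Greenberg1999LNM, §1 pp. 54–57] -/
theorem shaCotorsionReducible_of_thesis_of_smallImage : Summit.BirchSwinnertonDyer.BirchSwinnertonDyer.Theses.ShadowIsolation.ShadowIsolationThesis → Summit.BirchSwinnertonDyer.BirchSwinnertonDyer.Theses.ShadowIsolation.SelmerRankSmallImage → Summit.BirchSwinnertonDyer.BirchSwinnertonDyer.Theses.ShadowIsolation.ShaCotorsionReducible := by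
  intro hX hSI
  refine shaCotorsionReducible_of_thesis_of_smallImage_of_supply hX hSI ?_
  intro W _ _
  obtain ⟨q, h4q, ⟨hq, hqgood, hqord⟩, hqirr⟩ :=
    WeierstrassCurve.exists_gt_mem_goodOrdinaryPrimes_hasIrreducibleModPGaloisRep W 4
  exact ⟨q, hq, h4q, hqgood, hqord, hqirr⟩

end Summit.BirchSwinnertonDyer.BirchSwinnertonDyer.Theorems
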